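import Summits.BirchSwinnertonDyer.BirchSwinnertonDyer.Theorems.GenusKolyvaginAtTwoPowDvdShaCardAtTwoRTRungDescent
import Summits.BirchSwinnertonDyer.BirchSwinnertonDyer.Theorems.GenusKolyvaginAtTwoPowDvdShaCardAtTwoRTGenusKernelHabitat
import Literature.NumberTheory.EllipticCurves.BSDInvariantsProofs
import HarnessLib

/-!
# Route `GenusKolyvaginAtTwo`, LINE 18 (L_T `PowDvdShaCardAtTwoRT`, stmt-BirchSwinnertonDyer-23242), stub L
# `stub_twinShaLaddersAtTwo` — THE DESCENT LAYER (2/2): a rung of the TWIN's ℚ-side ladder from a family of `τ`-ANTI-FIXED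
# classes over `K`

Seat `bsd-line-gk2-p2` g18 (PROVER seat 2/3, cell `bsd-f1-sign2`), `--supports stmt-BirchSwinnertonDyer-23242` (helper; closes
nothing). THEOREMS ONLY (no definition, no named fact, no `sorry`); BSD is not proved by any of this.

WHY. The even-depth Kolyvagin classes `d_{M_{r−1}}(n)`, `r = 2m+2`, are `τ`-ANTI-fixed in `H¹(K, E_K[2^L])` (Gross Prop. 5.4 at
`2`, tree `sign_conjAct_kolyvaginClass_two`); stub L wants them as classes `y_i ∈ H¹(ℚ, Wd)` of the TWIN's globally minimal
ℚ-model `Wd = Cd • W^{(d_K)}` with `res_K y_i ∈ Ш(Wd_K/K)` (binder `hfam'`). The sibling file `…RTRungDescent` did the `τ = +1`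
side; this file does the `τ = −1` side, in three moves, each a tree atom: (i) along the `K`-twist isomorphism
`hPsiKT : H¹(K, E^{(c)}_K[n]) ≃ H¹(K, E_K[n])` (Literature `SelmerTorsionTwistRestriction`; `K = ℚ(θ)`, `θ² = c`) anti-fixed classes
of `E` are FIXED classes of `E^{(c)}` (`conjAct_hPsiKT`), Selmer ↔ Selmer (`mem_selmerGroup_iff_hPsiKT_mem`), and the Kummer kernels
`ker(H¹(K, ·[n]) → H¹(K, ·))` correspond (§1, functoriality of `H¹` in compatible pairs); (ii) fixed classes of `E^{(c)}` descend to
`H¹(ℚ, E^{(c)}[n])` (gk2-p3 `EigenClassesFinite.existsUnique_hPsiKT_resTorsion_eq_of_conjAct_eq_neg`, `E(K)[n] = 0`) and map to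
`H¹(ℚ, E^{(c)})`; (iii) the ℚ-isomorphism `Cd : E^{(c)} → Wd` carries `H¹(ℚ, E^{(c)}) ≃ H¹(ℚ, Wd)` respecting every local kernel
(Literature `galH1Equiv`, `mem_localRestrictionKer_iff_galH1Equiv_mem`), hence `res_K(·) ∈ Ш` (§2: `res_K x ∈ Ш(X_K)` is a place-by-place
condition on `x` over `ℚ`, `mem_localRestrictionKer_iff_resBaseChange_mem`).

* §1 `torsionH1ToH1_h1TorsionIso`, `torsionH1ToH1_h1TorsionIso_eq_zero_iff`, `torsionH1ToH1_hPsiKT_symm_eq_zero_iff` — Kummer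
  kernels under an isomorphism of curves / under `hPsiKT`.
* §2 `resBaseChange_mem_sha_iff_forall_mem_localRestrictionKer`, `resBaseChange_galH1Equiv_mem_sha_iff` — `res_K x ∈ Ш(X_K/K)` is
  invariant under a change of Weierstrass model over `ℚ`.
* §3 **`exists_galH1Family_twist_of_conjAct_eq_neg`** — anti-fixed `z : Fin s → H¹(K, E_K[n])` whose span meets the Kummer kernel
  trivially give `x' : Fin s → H¹(ℚ, E^{(c)})` with the SAME integer relations and `res_K x'_i = ι (hPsiKT⁻¹ z_i)`.
* §4 **`exists_shaFamily_twin_of_antifixed_selmerFamily`** — L's `hfam'` VERBATIM at one rung: `K` quadratic, `σ ≠ 1`,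
  `E(K)[n] = 0`, `Wd` ANY model of `W^{(d_K)}` over `ℚ` (`∃ C, C • W.quadraticTwist d_K = Wd`, L's binder); `z` SELMER, `σ z_i = −z_i`,
  orders `2^a`, independent mod `2^a`, span ∩ Kummer kernel `= 0` (McCallum's «`⟨c⟩ ∩ ⟨δE(K)⟩ = 0`», the Mordell–Weil line of `y_K`)
  ⟹ `∃ y : Fin s → Wd.galH1`, `resBaseChange Wd K (y i) ∈ (Wd.baseChange K).sha`, `addOrderOf (y i) = 2^a`, independent mod `2^a`.

References: [GrossLMS1991] §5 (5.1), Prop. 5.4; [McCallumLMS1991] §5 Prop. 5.2, Thm. 5.4 (p. 310); [SilvermanAEC2009] X.§4, X.5 Cor. 5.4;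
[Dokchitser2013ParityNotes] §4; [SerreGaloisCohomology1997] I.§2.4.
-/

set_option autoImplicit false
-- the Theorems namespace of this sub repeats the summit name by design (D-0017 nested layout)
set_option linter.dupNamespace false

noncomputable section

open scoped Classical

namespace Summit.BirchSwinnertonDyer.BirchSwinnertonDyer.Theorems.GenusExact.PlusDescent

open WeierstrassCurve NumberField IsDedekindDomain Field Literature.NumberTheory.EllipticCurves
  Literature.NumberTheory.GaloisRepresentations Literature.NumberTheory.QuadraticFields

universe u

/-! ## §1 Kummer kernels under an isomorphism of curves and under `hPsiKT` -/

section Iso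

variable {F : Type u} [Field F] {W₁ W₂ : WeierstrassCurve F} {V : VariableChange F} (n : ℤ)

/-- **`ι ∘ (V)_* = (V)_* ∘ ι` on `H¹`**: for `V • W₁ = W₂` the maps `H¹(F, W₁[n]) → H¹(F, W₁) ≃ H¹(F, W₂)` and
`H¹(F, W₁[n]) ≃ H¹(F, W₂[n]) → H¹(F, W₂)` agree (both are the map of the compatible pair `(id, W₁[n] ↪ W₁(F̄) ≃ W₂(F̄))`).
[cite: SerreGaloisCohomology1997, I.§2.4] [cite: SilvermanAEC2009, X.§4] -/
theorem torsionH1ToH1_h1TorsionIso (hV : V • W₁ = W₂) (s : galH1Torsion W₁ n) :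
    torsionH1ToH1 W₂ n (h1TorsionIso n hV s) =
      h1Equiv (twistPointsIso hV) (twistPointsIso_smul hV) (torsionH1ToH1 W₁ n s) := by
  change resH1Hom (ContinuousMonoidHom.id _) (geomTorsion W₂ n).subtype (fun _ _ ↦ rfl)
      (resH1Hom (ContinuousMonoidHom.id _) (torsionIso n hV : geomTorsion W₁ n →+ geomTorsion W₂ n)
        (torsionIso_smul n hV) s) =
    resH1Hom (ContinuousMonoidHom.id _) (twistPointsIso hV : geomPoints W₁ →+ geomPoints W₂) (twistPointsIso_smul hV)
      (resH1Hom (ContinuousMonoidHom.id _) (geomTorsion W₁ n).subtype (fun _ _ ↦ rfl) s)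
  rw [resH1Hom_resH1Hom, resH1Hom_resH1Hom]
  exact congrFun (congrArg DFunLike.coe (resH1Hom_congr rfl (by ext P; rfl) _ _)) s

/-- The Kummer kernels `ker(H¹(F, ·[n]) → H¹(F, ·))` of isomorphic curves correspond. [cite: SilvermanAEC2009, X.§4] -/
theorem torsionH1ToH1_h1TorsionIso_eq_zero_iff (hV : V • W₁ = W₂) (s : galH1Torsion W₁ n) :
    torsionH1ToH1 W₂ n (h1TorsionIso n hV s) = 0 ↔ torsionH1ToH1 W₁ n s = 0 := by
  rw [torsionH1ToH1_h1TorsionIso, map_eq_zero_iff _ (AddEquiv.injective _)]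

end Iso

section Twist

variable (W : WeierstrassCurve ℚ) (K : Type) [Field K] [NumberField K]
  (h2 : Module.finrank ℚ K = 2) {θ : K} {c : ℚ} (hθ : θ ∉ Set.range (algebraMap ℚ K))
  (hc : θ ^ 2 = algebraMap ℚ K c) (n : ℤ)

/-- **The Kummer kernels over `K` of `E` and `E^{(c)}` correspond under `hPsiKT`** (`hPsiKT` is a composite of two isomorphisms of
§1's kind). [cite: SilvermanAEC2009, X.5 Cor. 5.4 and X.§4] -/
theorem torsionH1ToH1_hPsiKT_symm_eq_zero_iff (y : galH1Torsion (W.baseChange K) n) :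
    torsionH1ToH1 ((W.quadraticTwist c).baseChange K) n ((hPsiKT W K hθ hc n).symm y) = 0 ↔
      torsionH1ToH1 (W.baseChange K) n y = 0 := by
  set s := (hPsiKT W K hθ hc n).symm y with hs
  have hy : y = hPsiKT W K hθ hc n s := by rw [hs, AddEquiv.apply_symm_apply]
  rw [hy, hPsiKT, AddEquiv.trans_apply]
  set t := (h1TorsionIso n (map_smul_baseChange_eq_quadraticTwist_one W (sqChange_spec W) (K := K))).symm
    (h1TorsionIso n (twistUntwist_smul_baseChange W hθ hc) s) with ht
  have ht' : h1TorsionIso n (twistUntwist_smul_baseChange W hθ hc) s =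
      h1TorsionIso n (map_smul_baseChange_eq_quadraticTwist_one W (sqChange_spec W) (K := K)) t := by
    rw [ht, AddEquiv.apply_symm_apply]
  rw [← torsionH1ToH1_h1TorsionIso_eq_zero_iff n (twistUntwist_smul_baseChange W hθ hc) s, ht',
    torsionH1ToH1_h1TorsionIso_eq_zero_iff]

end Twist

/-! ## §2 `res_K x ∈ Ш(X_K/K)` is a place-by-place condition over `ℚ`, invariant under a change of model -/

section ResSha

variable (K : Type) [Field K] [NumberField K] (X : WeierstrassCurve ℚ)

/-- `res_K x ∈ Ш(X_K/K)` iff `x` dies in `H¹(K_w, X)` at every place `w` of `K` (`mem_localRestrictionKer_iff_resBaseChange_mem`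
place by place). [cite: SilvermanAEC2009, X.§4] -/
theorem resBaseChange_mem_sha_iff_forall_mem_localRestrictionKer (x : X.galH1) :
    resBaseChange X K x ∈ (X.baseChange K).sha ↔
      (∀ v : HeightOneSpectrum (𝓞 K), x ∈ X.localRestrictionKer (v.adicCompletion K)) ∧
        ∀ w : InfinitePlace K, x ∈ X.localRestrictionKer w.Completion := by
  rw [mem_sha_iff]
  refine and_congr (forall_congr' fun v ↦ ?_) (forall_congr' fun w ↦ ?_)
  · exact (mem_localRestrictionKer_iff_resBaseChange_mem X x).symm
  · exact (mem_localRestrictionKer_iff_resBaseChange_mem X x).symm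

/-- **`res_K x ∈ Ш(X_K/K) ↔ res_K (C_* x) ∈ Ш((C • X)_K/K)`** for a change of Weierstrass model `C` over `ℚ` (`galH1Equiv`
respects every local kernel). [cite: SilvermanAEC2009, X.§4] -/
theorem resBaseChange_galH1Equiv_mem_sha_iff (C : VariableChange ℚ) (x : X.galH1) :
    resBaseChange (C • X) K (galH1Equiv X C x) ∈ ((C • X).baseChange K).sha ↔
      resBaseChange X K x ∈ (X.baseChange K).sha := by
  rw [resBaseChange_mem_sha_iff_forall_mem_localRestrictionKer, resBaseChange_mem_sha_iff_forall_mem_localRestrictionKer]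
  refine and_congr (forall_congr' fun v ↦ ?_) (forall_congr' fun w ↦ ?_)
  · exact (mem_localRestrictionKer_iff_galH1Equiv_mem X C _ x).symm
  · exact (mem_localRestrictionKer_iff_galH1Equiv_mem X C _ x).symm

end ResSha

/-! ## §3 Descent of a `τ`-anti-fixed family of `H¹(K, E_K[n])` to `H¹(ℚ, E^{(c)})` -/

section AntiFixed

variable (W : WeierstrassCurve ℚ) (K : Type) [Field K] [NumberField K]
  (h2 : Module.finrank ℚ K = 2) {θ : K} {c : ℚ} (hθ : θ ∉ Set.range (algebraMap ℚ K))
  (hc : θ ^ 2 = algebraMap ℚ K c) (n : ℤ)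

/-- Anti-fixed classes of `E` over `K` are, through `hPsiKT⁻¹`, FIXED classes of the twist `E^{(c)}` over `K` (`conjAct_hPsiKT`).
[cite: Dokchitser2013ParityNotes, §4] [cite: GrossLMS1991, §5 (5.1)] -/
theorem conjAct_hPsiKT_symm_eq_self_of_conjAct_eq_neg {y : galH1Torsion (W.baseChange K) n}
    (hy : conjAct W (sigmaQ K h2 hθ hc) n y = -y) :
    conjAct (W.quadraticTwist c) (sigmaQ K h2 hθ hc) n ((hPsiKT W K hθ hc n).symm y) = (hPsiKT W K hθ hc n).symm y := by
  apply (hPsiKT W K hθ hc n).injective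
  have h := conjAct_hPsiKT W K h2 hθ hc n ((hPsiKT W K hθ hc n).symm y)
  rw [AddEquiv.apply_symm_apply, hy, neg_inj] at h
  rw [AddEquiv.apply_symm_apply, ← h]

/-- **Descent of a `τ`-anti-fixed family to the twist.** `K = ℚ(θ)`, `θ² = c`, `σ₀` its conjugation, `E/ℚ` with `E(K)[n] = 0`;
`z_i ∈ H¹(K, E_K[n])` with `σ₀·z_i = −z_i`, whose span meets `ker(H¹(K, E_K[n]) → H¹(K, E_K))` trivially. Then there are
`x'_i ∈ H¹(ℚ, E^{(c)})` with `res_K x'_i = ι (hPsiKT⁻¹ z_i)` and the same integer relations as `z`.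
[cite: GrossLMS1991, §5 (5.1)] [cite: McCallumLMS1991, §5 Prop. 5.2] -/
theorem exists_galH1Family_twist_of_conjAct_eq_neg
    (hL : ∀ P : (W.baseChange K).toAffine.Point, n • P = 0 → P = 0)
    {s : ℕ} (z : Fin s → galH1Torsion (W.baseChange K) n)
    (hanti : ∀ i, conjAct W (sigmaQ K h2 hθ hc) n (z i) = -z i)
    (hker : ∀ e : Fin s → ℤ, torsionH1ToH1 (W.baseChange K) n (∑ i, e i • z i) = 0 → ∑ i, e i • z i = 0) :
    ∃ x' : Fin s → (W.quadraticTwist c).galH1,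
      (∀ i, resBaseChange (W.quadraticTwist c) K (x' i) =
        torsionH1ToH1 ((W.quadraticTwist c).baseChange K) n ((hPsiKT W K hθ hc n).symm (z i))) ∧
      ∀ e : Fin s → ℤ, ∑ i, e i • x' i = 0 ↔ ∑ i, e i • z i = 0 := by
  have hdesc : ∀ i, ∃ xt : galH1Torsion (W.quadraticTwist c) n,
      hPsiKT W K hθ hc n (resTorsion (W.quadraticTwist c) K n xt) = z i := fun i ↦
    (EigenClassesFinite.existsUnique_hPsiKT_resTorsion_eq_of_conjAct_eq_neg W K h2 hθ hc n hL (hanti i)).exists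
  choose xt hxt using hdesc
  have hxt' : ∀ i, resTorsion (W.quadraticTwist c) K n (xt i) = (hPsiKT W K hθ hc n).symm (z i) := fun i ↦ by
    rw [← hxt i, AddEquiv.symm_apply_apply]
  have hinjres := EigenClassesFinite.resTorsion_twist_injective_of_noTorsion W K h2 hθ hc n hL
  -- the composite `hPsiKT ∘ res` on the span of `xt`
  have hsumz : ∀ e : Fin s → ℤ, ∑ i, e i • z i =
      hPsiKT W K hθ hc n (resTorsion (W.quadraticTwist c) K n (∑ i, e i • xt i)) := fun e ↦ by
    rw [map_sum, map_sum]
    simp only [map_zsmul, hxt]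
  refine ⟨fun i ↦ torsionH1ToH1 (W.quadraticTwist c) n (xt i), fun i ↦ ?_, fun e ↦ ⟨fun h ↦ ?_, fun h ↦ ?_⟩⟩
  · rw [← torsionH1ToH1_resTorsion, hxt']
  · -- restrict to `K`, move the Kummer kernel along `hPsiKT`
    have h1 : resBaseChange (W.quadraticTwist c) K (∑ i, e i • torsionH1ToH1 (W.quadraticTwist c) n (xt i)) = 0 := by
      rw [h, map_zero]
    rw [map_sum] at h1
    simp only [map_zsmul, ← torsionH1ToH1_resTorsion] at h1
    have h2' : torsionH1ToH1 ((W.quadraticTwist c).baseChange K) n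
        (resTorsion (W.quadraticTwist c) K n (∑ i, e i • xt i)) = 0 := by
      rw [map_sum, map_sum]
      simpa only [map_zsmul] using h1
    have h3 : torsionH1ToH1 (W.baseChange K) n (∑ i, e i • z i) = 0 := by
      rw [hsumz, ← torsionH1ToH1_hPsiKT_symm_eq_zero_iff W K hθ hc n, AddEquiv.symm_apply_apply]
      exact h2'
    exact hker e h3
  · rw [hsumz, map_eq_zero_iff _ (hPsiKT W K hθ hc n).injective] at h
    have h0 : ∑ i, e i • xt i = 0 := hinjres (by rw [h, map_zero])
    have h1 := congrArg (torsionH1ToH1 (W.quadraticTwist c) n) h0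
    rw [map_sum, map_zero] at h1
    simpa only [map_zsmul] using h1

end AntiFixed

/-! ## §4 L's `hfam'` shape at one rung: Selmer + anti-fixed + orders + independence over `K` ⟹ the twin's ℚ-side family -/

section RungTwin

variable (W : WeierstrassCurve ℚ) (K : Type) [Field K] [NumberField K]
  (h2 : Module.finrank ℚ K = 2) (σ : K ≃ₐ[ℚ] K) (hσ : σ ≠ 1) (n : ℤ)

include h2 hσ in
/-- **ONE RUNG OF L's `Wd`-LADDER FROM KOLYVAGIN'S ANTI-FIXED K-CLASSES.** `K` quadratic, `σ ≠ 1` in `Aut(K/ℚ)`, `E/ℚ` (model `W`)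
with `E(K)[n] = 0`, `Wd` any ℚ-model of the twist by `d_K` (`∃ C, C • W.quadraticTwist d_K = Wd` — L's binder); `z : Fin s →
H¹(K, E_K[n])` SELMER, `σ z_i = −z_i`, of order `2^a`, independent modulo `2^a`, whose span meets `ker(H¹(K, E_K[n]) → H¹(K, E_K))`
(the Kummer line of `E(K)`) trivially. Then there are `y : Fin s → H¹(ℚ, Wd)` with `res_K y_i ∈ Ш(Wd_K/K)`, `ord y_i = 2^a`,
independent modulo `2^a` — the binder `hfam'` of stub L / of `two_mul_le_padicValNat_add_of_shaLadders` at this rung.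
[cite: McCallumLMS1991, §5 Prop. 5.2, Thm. 5.4 (p. 310)] [cite: GrossLMS1991, §5 (5.1), Prop. 5.4] [cite: SilvermanAEC2009, X.5 Cor. 5.4] -/
theorem exists_shaFamily_twin_of_antifixed_selmerFamily
    (hL : ∀ P : (W.baseChange K).toAffine.Point, n • P = 0 → P = 0)
    {Wd : WeierstrassCurve ℚ} (hWd : ∃ C : VariableChange ℚ, C • W.quadraticTwist (NumberField.discr K : ℚ) = Wd)
    {s a : ℕ} (z : Fin s → galH1Torsion (W.baseChange K) n)
    (hsel : ∀ i, z i ∈ selmerGroup (W.baseChange K) n)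
    (hanti : ∀ i, conjAct W σ n (z i) = -z i)
    (hker : ∀ e : Fin s → ℤ, torsionH1ToH1 (W.baseChange K) n (∑ i, e i • z i) = 0 → ∑ i, e i • z i = 0)
    (hord : ∀ i, addOrderOf (z i) = 2 ^ a)
    (hind : ∀ e : Fin s → ℤ, ∑ i, e i • z i = 0 → ∀ i, ((2 ^ a : ℕ) : ℤ) ∣ e i) :
    ∃ y : Fin s → Wd.galH1, (∀ i, resBaseChange Wd K (y i) ∈ (Wd.baseChange K).sha) ∧
      (∀ i, addOrderOf (y i) = 2 ^ a) ∧
      ∀ e : Fin s → ℤ, ∑ i, e i • y i = 0 → ∀ i, ((2 ^ a : ℕ) : ℤ) ∣ e i := by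
  -- `K = ℚ(θ₀)`, `θ₀² = d_K`, `σ = σ₀`
  obtain ⟨τ, θ₀, hτ, hθ₀, hsq, -, hall⟩ := exists_gal_ne_one_sqrt_discr (K := K) h2
  have hστ : σ = sigmaQ K h2 hθ₀ hsq := eq_sigmaQ_of_ne_one K h2 σ hσ hθ₀ hsq
  subst hστ
  obtain ⟨Cd, rfl⟩ := hWd
  -- §3: descend to `H¹(ℚ, E^{(d_K)})`
  obtain ⟨x', hres, hrel⟩ := exists_galH1Family_twist_of_conjAct_eq_neg W K h2 hθ₀ hsq n hL z hanti hker
  -- transport along `Cd`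
  refine ⟨fun i ↦ galH1Equiv (W.quadraticTwist (NumberField.discr K : ℚ)) Cd (x' i), fun i ↦ ?_, fun i ↦ ?_, ?_⟩
  · -- `res_K ∈ Ш`: invariant under `Cd`; for `x'` it is the Selmer property of `hPsiKT⁻¹ z_i`
    rw [resBaseChange_galH1Equiv_mem_sha_iff, hres i]
    have hz' : (hPsiKT W K hθ₀ hsq n).symm (z i) ∈ selmerGroup ((W.quadraticTwist (NumberField.discr K : ℚ)).baseChange K) n := by
      rw [mem_selmerGroup_iff_hPsiKT_mem W K hθ₀ hsq n, AddEquiv.apply_symm_apply]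
      exact hsel i
    rw [selmerGroup_eq_comap_sha, AddSubgroup.mem_comap] at hz'
    exact hz'
  · rw [AddEquiv.addOrderOf_eq, addOrderOf_eq_of_forall_sum_zsmul_eq_zero_iff x' z hrel i, hord i]
  · set G := galH1Equiv (W.quadraticTwist (NumberField.discr K : ℚ)) Cd with hG
    have hrel' : ∀ e : Fin s → ℤ, ∑ i, e i • G (x' i) = 0 ↔ ∑ i, e i • z i = 0 := fun e ↦ by
      rw [← hrel e]
      have h := sum_zsmul_map_eq_zero_iff_of_injOn_span G.toAddMonoidHom x'
        (fun e' he' ↦ G.injective (by rw [map_zero]; exact he')) e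
      simpa only [AddEquiv.coe_toAddMonoidHom] using h
    exact indep_of_forall_sum_zsmul_eq_zero_iff _ z hrel' hind

end RungTwin

end Summit.BirchSwinnertonDyer.BirchSwinnertonDyer.Theorems.GenusExact.PlusDescent

end
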